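import Summits.BirchSwinnertonDyer.BirchSwinnertonDyer.Theorems.UniversalToricDescentThinCombVisibility
import HarnessLib

/-!
# Thin-comb rigidity (crux idea `thin-comb-reflection` on `AdditiveSplitIMCInclusionAtThree`, item
# stmt-BirchSwinnertonDyer-20395) — Part III: the FINITENESS LEMMA and the CORE INDUCTION
# (helper, `--supports stmt-BirchSwinnertonDyer-20395`; cell `pub/bsd-wall`, lead `cruxlead-20395`)

* §5 FINITENESS (the algebraic form of "two coprime elements of `𝒪⟦T₁,T₂⟧` have finitely many common zeros"): in
  a Noetherian domain with `π ≠ 0`, elements `e_i` with `π ∈ (e_i, e_j)` (`i ≠ j`), `e_i ∤ π^N`, `e_i ∣ π^{t_i} f`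
  force `f = 0` — in `S[1/π]` the `e_i` are pairwise coprime non-units dividing `f`, giving an infinite strictly
  ascending chain of principal ideals `(f/e₀⋯e_n)`, impossible (`WfDvdMonoid`).
* §7 CORE INDUCTION: for a prime `Q ∤ p` of `Λ₂(𝒪) = 𝒪⟦T₂⟧⟦T₁⟧` that is VISIBLE (`p^N ∉ (Q, E_m)`) on comb levels
  of unbounded order on which `Q^k ∣ p^{t_m}·F (mod E_m(T₂))`, one has `Q^k ∣ F` (`pow_dvd_of_visible_levels`):
  §5 in the Noetherian domain `Λ₂/(Q)` gives `Q ∣ F`, and `Q` cancels from the level identities because it divides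
  at most one vertical element (COMB COPRIMALITY `p ∈ (E_m, E_{m'})`).

`𝒪` is a discrete valuation ring with maximal ideal `(p)`. Nothing about elliptic curves; BSD is not proved by any of
this. References: Washington, §7.1–7.2 [cite: Washington1997, §7.1–§7.2]; Matsumura, Thm. 20.3 [cite: Matsumura1987, Thm. 20.3].
-/

set_option linter.dupNamespace false

noncomputable section

namespace Summit.BirchSwinnertonDyer.BirchSwinnertonDyer.Theorems.UniversalToricDescentThinComb

open Polynomial

/-! ## §5 Finiteness: infinitely many pairwise `p`-comaximal non-unit divisors force `f = 0` -/

section Finiteness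

variable {S : Type*} [CommRing S] [IsDomain S] [IsNoetherianRing S]

/-- **Finiteness lemma.** In a Noetherian domain `S` with `π ≠ 0`, let `e₀, e₁, …` satisfy: `π ∈ (e_i, e_j)` for
`i ≠ j` (distinct comb levels meet only above `π`), no `e_i` divides a power of `π` (each level is VISIBLE), and every
`e_i` divides `π^{t_i}·f`. Then `f = 0`. Proof: in `S[1/π]` the `e_i` become pairwise coprime non-units dividing `f`,
so `f = e₀ e₁ ⋯ e_n · b_n` with `b_n = e_{n+1} b_{n+1}`, an infinite strictly ascending chain of principal ideals —
impossible in the Noetherian domain `S[1/π]`. (The algebraic form of "two coprime elements of `𝒪⟦T₁,T₂⟧` have only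
finitely many common zeros".) [cite: Washington1997, §7.1; Matsumura1987, Thm. 20.3] -/
theorem eq_zero_of_dvd_on_levels {π f : S} (hπ : π ≠ 0) (e : ℕ → S)
    (hcop : ∀ i j : ℕ, i ≠ j → π ∈ Ideal.span {e i, e j})
    (hvis : ∀ (i N : ℕ), ¬ (e i ∣ π ^ N))
    (hdvd : ∀ i : ℕ, ∃ t : ℕ, e i ∣ π ^ t * f) : f = 0 := by
  classical
  by_contra hf
  -- work in `S' = S[1/π]`
  let S' := Localization.Away π
  haveI : IsDomain S' := IsLocalization.Away.isDomain (S := S') hπ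
  haveI : IsNoetherianRing S' := IsLocalization.isNoetherianRing (Submonoid.powers π) S' inferInstance
  let ι : S →+* S' := algebraMap S S'
  have hinj : Function.Injective ι :=
    IsLocalization.injective S' (powers_le_nonZeroDivisors_of_noZeroDivisors hπ)
  have hπu : IsUnit (ι π) := IsLocalization.Away.algebraMap_isUnit π
  let e' : ℕ → S' := fun i => ι (e i)
  have hf' : ι f ≠ 0 := fun h => hf (hinj (by rw [h, map_zero]))
  -- the `e' i` are non-units
  have hnu : ∀ i, ¬ IsUnit (e' i) := by
    intro i hu
    obtain ⟨m, hm, hdm⟩ := (IsLocalization.algebraMap_isUnit_iff (M := Submonoid.powers π) (S := S')).mp hu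
    obtain ⟨N, rfl⟩ := (Submonoid.mem_powers_iff _ _).mp hm
    exact hvis i N hdm
  -- pairwise coprime
  have hcop' : ∀ i j : ℕ, i ≠ j → IsCoprime (e' i) (e' j) := by
    intro i j hij
    obtain ⟨a, b, hab⟩ := Ideal.mem_span_pair.mp (hcop i j hij)
    obtain ⟨w, hw⟩ := hπu
    refine ⟨↑w⁻¹ * ι a, ↑w⁻¹ * ι b, ?_⟩
    have : ι a * e' i + ι b * e' j = ι π := by
      simp only [e', ← map_mul, ← map_add, hab]
    calc ↑w⁻¹ * ι a * e' i + ↑w⁻¹ * ι b * e' j = ↑w⁻¹ * (ι a * e' i + ι b * e' j) := by ring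
      _ = 1 := by rw [this, ← hw, Units.inv_mul]
  -- each `e' i` divides `f`
  have hdvd' : ∀ i, e' i ∣ ι f := by
    intro i
    obtain ⟨t, c, hc⟩ := hdvd i
    obtain ⟨w, hw⟩ := hπu
    refine ⟨ι c * ↑(w ^ t)⁻¹, ?_⟩
    have : ι π ^ t * ι f = e' i * ι c := by
      simp only [e', ← map_mul, ← map_pow, hc]
    rw [← mul_assoc, ← this, ← hw, ← Units.val_pow_eq_pow_val, mul_comm (↑(w ^ t) : S') (ι f), mul_assoc,
      Units.mul_inv, mul_one]
  -- products of the first `n` divide `f`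
  have hprod : ∀ n : ℕ, (∏ i ∈ Finset.range n, e' i) ∣ ι f := by
    intro n
    refine Finset.prod_dvd_of_coprime ?_ (fun i _ => hdvd' i)
    intro i _ j _ hij
    exact hcop' i j hij
  choose b hb using hprod
  -- `b n = e' n * b (n+1)`
  have hprod_ne : ∀ n : ℕ, (∏ i ∈ Finset.range n, e' i) ≠ 0 := by
    intro n
    refine Finset.prod_ne_zero_iff.mpr fun i _ h0 => ?_
    exact hnu i (h0 ▸ hdvd' i |>.elim fun c hc => absurd (by rw [hc, zero_mul]) hf')
  have hrel : ∀ n : ℕ, b n = e' n * b (n + 1) := by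
    intro n
    have h1 := hb n
    have h2 := hb (n + 1)
    rw [Finset.prod_range_succ, h1, mul_assoc] at h2
    exact mul_left_cancel₀ (hprod_ne n) h2
  have hbne : ∀ n, b n ≠ 0 := by
    intro n h0
    exact hf' (by rw [hb n, h0, mul_zero])
  have hchain : ∀ n, DvdNotUnit (b (n + 1)) (b n) :=
    fun n => ⟨hbne (n + 1), e' n, hnu n, by rw [hrel n, mul_comm]⟩
  exact (wellFounded_iff_isEmpty_descending_chain.mp
    (wellFounded_dvdNotUnit (α := S'))).elim ⟨b, hchain⟩

end Finiteness

/-! ## §7 The rigidity theorem -/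

section Main

variable (𝒪 : Type*) [CommRing 𝒪] [IsDomain 𝒪] [IsDiscreteValuationRing 𝒪] (p : ℕ) [hp : Fact p.Prime]

omit [IsDomain 𝒪] [IsDiscreteValuationRing 𝒪] in
/-- COMB COPRIMALITY in `Λ₂(𝒪)`: `p ∈ (E_m(T₂), E_{m'}(T₂))` for `m ≠ m'`. [cite: Washington1997, Lemma 1.4] -/
theorem const_p_mem_span_combElt {m m' : ℕ} (h : m ≠ m') :
    const 𝒪 (p : 𝒪) ∈ Ideal.span {combElt 𝒪 p m, combElt 𝒪 p m'} := by
  obtain ⟨a, b, hab⟩ := Ideal.mem_span_pair.mp (p_mem_span_combSeries 𝒪 p h)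
  rw [Ideal.mem_span_pair]
  refine ⟨PowerSeries.C a, PowerSeries.C b, ?_⟩
  rw [combElt, combElt, ← map_mul, ← map_mul, ← map_add, hab]; rfl

omit [IsDomain 𝒪] [IsDiscreteValuationRing 𝒪] in
/-- A prime `Q ∤ p` of `Λ₂(𝒪)` divides at most one vertical element `E_m(T₂)`. [cite: Washington1997, Lemma 1.4] -/
theorem eq_of_prime_dvd_combElt {Q : PowerSeries (PowerSeries 𝒪)} (hQp : ¬ Q ∣ const 𝒪 (p : 𝒪))
    {m m' : ℕ} (hm : Q ∣ combElt 𝒪 p m) (hm' : Q ∣ combElt 𝒪 p m') : m = m' := by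
  by_contra hne
  obtain ⟨a, b, hab⟩ := Ideal.mem_span_pair.mp (const_p_mem_span_combElt 𝒪 p hne)
  exact hQp (hab ▸ dvd_add (dvd_mul_of_dvd_right hm a) (dvd_mul_of_dvd_right hm' b))

omit [IsDomain 𝒪] [IsDiscreteValuationRing 𝒪] in
/-- Discarding the (at most one) level whose vertical element `Q` divides. [cite: Washington1997, Lemma 1.4] -/
theorem levels_avoiding {Q : PowerSeries (PowerSeries 𝒪)} (hQp : ¬ Q ∣ const 𝒪 (p : 𝒪))
    {P : ℕ → Prop} (H : ∀ n : ℕ, ∃ m : ℕ, n ≤ m ∧ P m) :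
    ∀ n : ℕ, ∃ m : ℕ, n ≤ m ∧ ¬ Q ∣ combElt 𝒪 p m ∧ P m := by
  intro n
  obtain ⟨m₁, h₁, P₁⟩ := H n
  by_cases hd : Q ∣ combElt 𝒪 p m₁
  · obtain ⟨m₂, h₂, P₂⟩ := H (m₁ + 1)
    refine ⟨m₂, by omega, fun hd₂ => ?_, P₂⟩
    have := eq_of_prime_dvd_combElt 𝒪 p hQp hd hd₂
    omega
  · exact ⟨m₁, h₁, hd, P₁⟩

/-- **Core induction.** Let `Q ∤ p` be a prime of `Λ₂(𝒪)`. If on comb levels of unbounded order `Q` is VISIBLE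
(`p^N ∉ (Q, E_m)` for all `N`), `Q ∤ E_m`, and `Q^k ∣ p^{t_m} F` modulo `E_m`, then `Q^k ∣ F`. Step `k → k+1`: the
finiteness lemma in the Noetherian domain `Λ₂/(Q)` gives `Q ∣ F`, and `Q` cancels from the level identities.
[cite: Washington1997, §7.1–§7.2; Matsumura1987, Thm. 20.3] -/
theorem pow_dvd_of_visible_levels (hmax : IsLocalRing.maximalIdeal 𝒪 = Ideal.span {(p : 𝒪)})
    {Q : PowerSeries (PowerSeries 𝒪)} (hQ : Prime Q) (hQp : ¬ Q ∣ const 𝒪 (p : 𝒪)) :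
    ∀ (k : ℕ) (F : PowerSeries (PowerSeries 𝒪)),
      (∀ n : ℕ, ∃ m : ℕ, n ≤ m ∧ ¬ Q ∣ combElt 𝒪 p m ∧
        (∀ N : ℕ, const 𝒪 ((p : 𝒪) ^ N) ∉ Ideal.span {Q, combElt 𝒪 p m}) ∧
        ∃ t : ℕ, const 𝒪 ((p : 𝒪) ^ t) * F ∈ Ideal.span {Q ^ k, combElt 𝒪 p m}) →
      Q ^ k ∣ F := by
  classical
  obtain ⟨hp0, hpu, hprime, hpprime⟩ := p_ne_zero_of_maximalIdeal_eq 𝒪 p hmax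
  intro k
  induction k with
  | zero => intro F _; simp
  | succ k ih =>
    intro F H
    -- Step 1: `Q ∣ F`, by the finiteness lemma in `Λ₂ / (Q)`
    have hQF : Q ∣ F := by
      haveI hI : (Ideal.span {Q}).IsPrime := (Ideal.span_singleton_prime hQ.ne_zero).mpr hQ
      let πQ := Ideal.Quotient.mk (Ideal.span {Q})
      have hπp : πQ (const 𝒪 (p : 𝒪)) ≠ 0 := by
        rw [Ne, Ideal.Quotient.eq_zero_iff_mem, Ideal.mem_span_singleton]; exact hQp
      choose φ hφle hφnd hφvis hφmem using H
      -- strictly increasing sequence of good levels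
      let ms : ℕ → ℕ := fun i => Nat.rec (φ 0) (fun _ r => φ (r + 1)) i
      have hms_succ : ∀ i, ms (i + 1) = φ (ms i + 1) := fun i => rfl
      have hms_mono : StrictMono ms := strictMono_nat_of_lt_succ fun i => by
        rw [hms_succ]; exact Nat.lt_of_lt_of_le (Nat.lt_succ_self _) (hφle _)
      have hms_good : ∀ i, (∀ N : ℕ, const 𝒪 ((p : 𝒪) ^ N) ∉ Ideal.span {Q, combElt 𝒪 p (ms i)}) ∧
          ∃ t : ℕ, const 𝒪 ((p : 𝒪) ^ t) * F ∈ Ideal.span {Q ^ (k + 1), combElt 𝒪 p (ms i)} := by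
        intro i
        cases i with
        | zero => exact ⟨hφvis 0, hφmem 0⟩
        | succ i => rw [hms_succ]; exact ⟨hφvis _, hφmem _⟩
      have hzero : πQ F = 0 := by
        refine eq_zero_of_dvd_on_levels (S := PowerSeries (PowerSeries 𝒪) ⧸ Ideal.span {Q}) hπp
          (fun i => πQ (combElt 𝒪 p (ms i))) ?_ ?_ ?_
        · intro i j hij
          obtain ⟨a, b, hab⟩ := Ideal.mem_span_pair.mp
            (const_p_mem_span_combElt 𝒪 p (hms_mono.injective.ne hij))
          rw [Ideal.mem_span_pair]
          exact ⟨πQ a, πQ b, by rw [← map_mul, ← map_mul, ← map_add, hab]⟩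
        · rintro i N ⟨c, hc⟩
          obtain ⟨c, rfl⟩ := Ideal.Quotient.mk_surjective c
          rw [← map_pow, ← map_mul, Ideal.Quotient.eq, Ideal.mem_span_singleton'] at hc
          obtain ⟨a, ha⟩ := hc
          apply (hms_good i).1 N
          rw [Ideal.mem_span_pair]
          exact ⟨a, c, by rw [map_pow, ha]; ring⟩
        · intro i
          obtain ⟨t, ht⟩ := (hms_good i).2
          obtain ⟨a, b, hab⟩ := Ideal.mem_span_pair.mp ht
          refine ⟨t, πQ b, ?_⟩
          have hQ0 : πQ Q = 0 := Ideal.Quotient.eq_zero_iff_mem.mpr (Ideal.mem_span_singleton_self _)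
          rw [← map_pow, ← map_mul, ← map_pow, ← hab, map_add, map_mul, map_mul, map_pow, hQ0,
            zero_pow (Nat.succ_ne_zero k), mul_zero, zero_add, mul_comm]
      rw [Ideal.Quotient.eq_zero_iff_mem, Ideal.mem_span_singleton] at hzero
      exact hzero
    obtain ⟨F₁, rfl⟩ := hQF
    -- Step 2: cancel `Q` and apply the induction hypothesis to `F₁`
    rw [pow_succ']
    refine mul_dvd_mul_left Q (ih F₁ fun n => ?_)
    obtain ⟨m, hnm, hnd, hvis, t, hmem⟩ := H n
    refine ⟨m, hnm, hnd, hvis, t, ?_⟩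
    obtain ⟨a, b, hab⟩ := Ideal.mem_span_pair.mp hmem
    have hQb : Q ∣ b := by
      have : Q ∣ b * combElt 𝒪 p m := by
        refine ⟨const 𝒪 ((p : 𝒪) ^ t) * F₁ - a * Q ^ k, ?_⟩
        rw [mul_sub, ← mul_assoc, mul_comm Q (const 𝒪 _), mul_assoc, ← hab]; ring
      exact (hQ.dvd_or_dvd this).resolve_right hnd
    obtain ⟨b', rfl⟩ := hQb
    rw [Ideal.mem_span_pair]
    refine ⟨a, b', mul_left_cancel₀ hQ.ne_zero ?_⟩
    rw [mul_add, ← mul_assoc, mul_comm Q a, mul_assoc, ← pow_succ', ← mul_assoc, hab]; ring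

/-- Visibility from the shape lemmas: if the reduction of `Q` at level `m` is not `ϖ^s·(unit)` then no power of `p`
lies in `(Q, E_m)`. [cite: Washington1997, §7.1–§7.2] -/
theorem visible_of_not_shape (hmax : IsLocalRing.maximalIdeal 𝒪 = Ideal.span {(p : 𝒪)}) (m : ℕ)
    {Q : PowerSeries (PowerSeries 𝒪)}
    (h : ¬ ∃ (s : ℕ) (u : PowerSeries (LevelRing 𝒪 p m)), IsUnit u ∧
      PowerSeries.map (Ideal.Quotient.mk (Ideal.span {combSeries 𝒪 p m})) Q =
        PowerSeries.C ((Ideal.Quotient.mk (Ideal.span {combSeries 𝒪 p m}) PowerSeries.X) ^ s) * u) :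
    ∀ N : ℕ, const 𝒪 ((p : 𝒪) ^ N) ∉ Ideal.span {Q, combElt 𝒪 p m} :=
  fun _ hN => h (shape_of_const_pow_mem 𝒪 p m hmax hN)

end Main

end Summit.BirchSwinnertonDyer.BirchSwinnertonDyer.Theorems.UniversalToricDescentThinComb

end
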